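import Summits.QuantumFields.YangMills.Theorems.UnitScaleTiltProp8HalvingDressingLetter
import Summits.QuantumFields.YangMills.Theorems.UnitScaleTiltProp8FlatProp4Bg1CubeSeq
import HarnessLib

/-!
# Route `UnitScaleTilt`, crux K1 child «MinimiserStabilityRegPr» (stmt-QuantumFields-19200), registered stub V2′ `stub_halvingStep`
# (skeletons v8 5b4e846794b80374 ∕ v10 `BirthV10`) — **THE DRESSING LETTER `C_E` AT THE d = 3 CARRIER: the cube-sequence reading with P3b's `W₀`
# BY NAME, and the one-level `hE` binder of `FlatProp4Dressing.exists_dressed_gradient_T3`** (companion of `UnitScaleTiltProp8HalvingDressingLetter`;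
# ★★OWNER g25 W-SEAT MAP #3 row M2 (H-CE), OWNER g26 ASSIGNMENTS 8 (b))

Cell `ym3-torus` (HUMAN RULING D-0037, YM ladder rung R3 — continuum SU(2) YM₃ on the torus is a RUNG, not the Clay problem), width seat
`ym-ust-19200-w6` gen 0 (D-0154 (3c)).  `--supports stmt-QuantumFields-19200 --as helper`; def-free, 0 sorry, standard axioms.

WHAT THIS FILE PROVES (no definition, no sorry; `η = L^{−(K−n)}`, lattice factor `c = L^{K−n}`):
* §1 `sum_trace_plaq_comm`, ★`curlCurl_pairing_symm` (`Σ_b tr(CC Z b·W b) = Σ_b tr(CC W b·Z b)` — the `hCCsym` input of ★w8-19936 g0's `X2a_of_X2D_CCHt`),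
  ★`exists_linearMap_curlCurl` (the flat curl–curl `CC Z b = η⁻²Σ_p σ(p,b)•Φ_p(Z)` IS the coercion of a ℂ-linear map — so letters stated for
  `CC : (ι → M₂) →ₗ[ℂ] (ι → M₂)` instantiate at it by `rw`).
* §2 ★★**`exists_hWq_dressed_cubeSeq_T3`** — at the aligned cube sequence (144) `cubeSeqMT3 F n K x₀ ρ S M` (level weights `w`, `IsLevWeight`) with P3b's
  pure-action gradient `W₀` BY NAME (✓ p600749 `FlatProp4Bg1.exists_gradient_weighted98_cubeSeq_T3`: the (grad) identity for `𝒱_η`, entire, level-weighted (98)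
  with `a₀ = 1/(2L)`, `C₀ = 12L³(1428 + L)`): for ANY chart data `H` ((46), `B_H`), `D` ((55)), the EXPLICIT dressing term `E` of
  `HalvingDressedCriticality.fderiv_dressed_eq_pairing` for this `W₀`, and the displayed supplier letters (X1), (X2a), (X2-T)
  (`HalvingDressingLetter.hWq_dressed_of_letters`), Proposition 4's (98) holds for `W = W₀∘(1 − H∘D) + E` in EXACTLY the `hWq` binder shape of ✓ p603846
  `HalvingA1Row165TraceAnyW.row165_of_tracePairing_L5_anyW`: `w 3 b·‖(W₀(Y − H(D Y)) + E Y)(b)‖ ≤ C₄·r²` for `r < a₃`,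
  `C₄ = C₀θ² + 2B_ΔC₂ + ½B₂θ + B₃R₀C₀θ²`, `θ = 1 + 4B_HC₂R₀`, `a₃ ≤ R₀ < R`, `θa₃ ≤ 1/(2L)`.  The same `W₀` serves the criticality side
  (`HalvingDressedCriticality.tracePairing_of_isMinOn_dressed_wilson` via `FlatActionGradient`).
* **`hE_T3_of_letters`** — the one-level reading (`w₀ = w₃ = 1`, `w₁ = L^{K−n}`, gradient letter in the `∀ x μ ν` form): LITERALLY the `hE` binder of
  ✓ p598408 `FlatProp4Dressing.exists_dressed_gradient_T3` (with its `R := a₃`), from the one-level letters.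
HONEST SCOPE.  NO supplier letter is proved here ((X1) matrix∕chart bridge, (X2a)∕(X2-T) = ★w8-19936 g0's `DressingTransposeLetters` modulo (X2-H)∕(X2-C′)∕(X2-CH),
(46) two-letter level modulo (X3′), (55) = P3a); NOT a claim about the stub, the crux, the rung or the mass gap; no summit statement is proved by this seat.

References: T. Bałaban, CMP **102** (1985) 277–309 [Balaban1985Variational] (46) p.285, (55) p.286, (80)–(89) pp.290–291, Prop. 4 (97)–(98) pp.292–293,
(144) p.300, (152) p.301, (157)–(158) p.302.
-/

set_option autoImplicit false

noncomputable section

open scoped BigOperators Matrix Matrix.Norms.L2Operator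
open NormedSpace

namespace Summit.QuantumFields.YangMills.Theorems.HalvingDressingLetter

open Literature.MathematicalPhysics.QuantumFieldTheory.Balaban1983to89

/-! ## §1 The flat curl–curl `CC` as a symmetric ℂ-linear operator — the `CC`∕`hCCsym` inputs of `DressingTransposeLetters.X2a_of_X2D_CCHt` -/

section ExplicitSym

variable {P : Params}

/-- **THE PLAQUETTE PAIRING IS SYMMETRIC**: `Σ_p tr(Φ_p(A)Φ_p(V)) = Σ_p tr(Φ_p(V)Φ_p(A))`. [folklore] -/
theorem sum_trace_plaq_comm (A V : PBond P 0 → Matrix (Fin 2) (Fin 2) ℂ) :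
    ∑ p : Plaq P 0, Matrix.trace ((A ⟨p.src, p.μ⟩ + A ⟨p.src.shift p.μ, p.ν⟩ - A ⟨p.src.shift p.ν, p.μ⟩ - A ⟨p.src, p.ν⟩) * (V ⟨p.src, p.μ⟩ + V ⟨p.src.shift p.μ, p.ν⟩ - V ⟨p.src.shift p.ν, p.μ⟩ - V ⟨p.src, p.ν⟩)) = ∑ p : Plaq P 0, Matrix.trace ((V ⟨p.src, p.μ⟩ + V ⟨p.src.shift p.μ, p.ν⟩ - V ⟨p.src.shift p.ν, p.μ⟩ - V ⟨p.src, p.ν⟩) * (A ⟨p.src, p.μ⟩ + A ⟨p.src.shift p.μ, p.ν⟩ - A ⟨p.src.shift p.ν, p.μ⟩ - A ⟨p.src, p.ν⟩)) :=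
  Finset.sum_congr rfl fun _ _ => Matrix.trace_mul_comm _ _

/-- **`CC` IS SYMMETRIC FOR THE TRACE PAIRING** (the `hCCsym` input of ★w8-19936 g0's `X2a_of_X2D_CCHt`): `Σ_b tr(CC Z b·W b) = Σ_b tr(CC W b·Z b)` for the
flat curl–curl `CC Z b = η⁻²Σ_p σ(p,b)•Φ_p(Z)` — both sides are `η⁻²Σ_p tr(Φ_p(Z)Φ_p(W))` by `sum_trace_plaq_mul`. [cite: Balaban1984PropagatorsII, (2.19) p.226] -/
theorem curlCurl_pairing_symm (η : ℝ) (Z W : PBond P 0 → Matrix (Fin 2) (Fin 2) ℂ) :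
    ∑ b : PBond P 0, Matrix.trace ((((η : ℂ) ^ 2)⁻¹ • ∑ p : Plaq P 0, ((Pi.single b (1 : ℂ) : PBond P 0 → ℂ) ⟨p.src, p.μ⟩ + (Pi.single b (1 : ℂ) : PBond P 0 → ℂ) ⟨p.src.shift p.μ, p.ν⟩ - (Pi.single b (1 : ℂ) : PBond P 0 → ℂ) ⟨p.src.shift p.ν, p.μ⟩ - (Pi.single b (1 : ℂ) : PBond P 0 → ℂ) ⟨p.src, p.ν⟩) • (Z ⟨p.src, p.μ⟩ + Z ⟨p.src.shift p.μ, p.ν⟩ - Z ⟨p.src.shift p.ν, p.μ⟩ - Z ⟨p.src, p.ν⟩)) * W b) = ∑ b : PBond P 0, Matrix.trace ((((η : ℂ) ^ 2)⁻¹ • ∑ p : Plaq P 0, ((Pi.single b (1 : ℂ) : PBond P 0 → ℂ) ⟨p.src, p.μ⟩ + (Pi.single b (1 : ℂ) : PBond P 0 → ℂ) ⟨p.src.shift p.μ, p.ν⟩ - (Pi.single b (1 : ℂ) : PBond P 0 → ℂ) ⟨p.src.shift p.ν, p.μ⟩ - (Pi.single b (1 : ℂ) : PBond P 0 → ℂ)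 ⟨p.src, p.ν⟩) • (W ⟨p.src, p.μ⟩ + W ⟨p.src.shift p.μ, p.ν⟩ - W ⟨p.src.shift p.ν, p.μ⟩ - W ⟨p.src, p.ν⟩)) * Z b) := by
  simp only [Matrix.smul_mul, Matrix.trace_smul, ← Finset.smul_sum, ← sum_trace_plaq_mul]
  rw [sum_trace_plaq_comm]

/-- **`CC` IS (THE COERCION OF) A ℂ-LINEAR MAP** — so that letters stated for `CC : (ι → M₂) →ₗ[ℂ] (ι → M₂)` (★w8-19936 g0's shapes) instantiate at the flat
curl–curl by `rw`. [cite: Balaban1984PropagatorsII, (2.19) p.226] -/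
theorem exists_linearMap_curlCurl (η : ℝ) :
    ∃ CC : (PBond P 0 → Matrix (Fin 2) (Fin 2) ℂ) →ₗ[ℂ] (PBond P 0 → Matrix (Fin 2) (Fin 2) ℂ), ∀ (Z : PBond P 0 → Matrix (Fin 2) (Fin 2) ℂ) (b : PBond P 0), CC Z b = (((η : ℂ) ^ 2)⁻¹ • ∑ p : Plaq P 0, ((Pi.single b (1 : ℂ) : PBond P 0 → ℂ) ⟨p.src, p.μ⟩ + (Pi.single b (1 : ℂ) : PBond P 0 → ℂ) ⟨p.src.shift p.μ, p.ν⟩ - (Pi.single b (1 : ℂ) : PBond P 0 → ℂ) ⟨p.src.shift p.ν, p.μ⟩ - (Pi.single b (1 : ℂ) : PBond P 0 → ℂ) ⟨p.src, p.ν⟩) • (Z ⟨p.src, p.μ⟩ + Z ⟨p.src.shift p.μ, p.ν⟩ - Z ⟨p.src.shift p.ν, p.μ⟩ - Z ⟨p.src, p.ν⟩)) := by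
  refine ⟨{ toFun := fun Z b => (((η : ℂ) ^ 2)⁻¹ • ∑ p : Plaq P 0, ((Pi.single b (1 : ℂ) : PBond P 0 → ℂ) ⟨p.src, p.μ⟩ + (Pi.single b (1 : ℂ) : PBond P 0 → ℂ) ⟨p.src.shift p.μ, p.ν⟩ - (Pi.single b (1 : ℂ) : PBond P 0 → ℂ) ⟨p.src.shift p.ν, p.μ⟩ - (Pi.single b (1 : ℂ) : PBond P 0 → ℂ) ⟨p.src, p.ν⟩) • (Z ⟨p.src, p.μ⟩ + Z ⟨p.src.shift p.μ, p.ν⟩ - Z ⟨p.src.shift p.ν, p.μ⟩ - Z ⟨p.src, p.ν⟩)), map_add' := fun Z W => ?_, map_smul' := fun a Z => ?_ }, fun Z b => rfl⟩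
  · funext b
    simp only [Pi.add_apply]
    rw [← smul_add, ← Finset.sum_add_distrib]
    congr 1
    refine Finset.sum_congr rfl fun p _ => ?_
    rw [← smul_add]
    congr 1
    abel
  · funext b
    simp only [Pi.smul_apply, RingHom.id_apply]
    have h1 : ∀ p : Plaq P 0, ((Pi.single b (1 : ℂ) : PBond P 0 → ℂ) ⟨p.src, p.μ⟩ + (Pi.single b (1 : ℂ) : PBond P 0 → ℂ) ⟨p.src.shift p.μ, p.ν⟩ - (Pi.single b (1 : ℂ) : PBond P 0 → ℂ) ⟨p.src.shift p.ν, p.μ⟩ - (Pi.single b (1 : ℂ) : PBond P 0 → ℂ) ⟨p.src, p.ν⟩) • (a • Z ⟨p.src, p.μ⟩ + a • Z ⟨p.src.shift p.μ, p.ν⟩ - a • Z ⟨p.src.shift p.ν, p.μ⟩ - a • Z ⟨p.src, p.ν⟩) =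
        a • (((Pi.single b (1 : ℂ) : PBond P 0 → ℂ) ⟨p.src, p.μ⟩ + (Pi.single b (1 : ℂ) : PBond P 0 → ℂ) ⟨p.src.shift p.μ, p.ν⟩ - (Pi.single b (1 : ℂ) : PBond P 0 → ℂ) ⟨p.src.shift p.ν, p.μ⟩ - (Pi.single b (1 : ℂ) : PBond P 0 → ℂ) ⟨p.src, p.ν⟩) • (Z ⟨p.src, p.μ⟩ + Z ⟨p.src.shift p.μ, p.ν⟩ - Z ⟨p.src.shift p.ν, p.μ⟩ - Z ⟨p.src, p.ν⟩)) := fun p => by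
      rw [← smul_add, ← smul_sub, ← smul_sub, smul_comm]
    rw [Finset.sum_congr rfl fun p _ => h1 p, ← Finset.smul_sum, smul_smul, smul_smul, mul_comm]

end ExplicitSym

/-! ## §2 The d = 3 readings -/

section T3

open T3ContinuumYM3Torus (T3Family)
open FlatCubeOpsText (IsLevWeight)
open FlatCubeSequenceAligned (cubeSeqMT3)
open FlatProp4Bg1 (exists_gradient_weighted98_cubeSeq_T3)

/-- **THE M2 KNIT AT THE ALIGNED CUBE SEQUENCE (144) CENTRED AT `x₀`, P3b BY NAME** (`η = L^{−(K−n)}`, level weights `w` of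
`cubeSeqMT3 F n K x₀ ρ S M`, `IsLevWeight`): P3b's pure-action gradient `W₀` (✓ `FlatProp4Bg1.exists_gradient_weighted98_cubeSeq_T3`: the (grad) identity for
`𝒱_η`, entire, level-weighted (98) with `a₀ = 1/(2L)`, `C₀ = 12L³(1428 + L)`) dressed by ANY chart data `H` ((46), `B_H`), `D` ((55), `4C₂r²` below `R`) and the
EXPLICIT dressing term `E` of `HalvingDressedCriticality.fderiv_dressed_eq_pairing` for THIS `W₀`, under the displayed supplier letters (X1), (X2a), (X2-T), satisfies
Proposition 4's (98) in EXACTLY the `hWq` binder shape of ✓ `HalvingA1Row165TraceAnyW.row165_of_tracePairing_L5_anyW` ∕ `FlatSmallSolution158CubeSeq`: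
`w 3 b·‖(W₀(Y − H(D Y)) + E Y)(b)‖ ≤ C₄·r²` for `r < a₃`, `C₄ = C₀θ² + 2B_ΔC₂ + ½B₂θ + B₃R₀C₀θ²`, `θ = 1 + 4B_HC₂R₀`, whenever `a₃ ≤ R₀ < R` and
`θ·a₃ ≤ 1/(2L)`.  The same `W₀` serves the criticality side (`tracePairing_of_isMinOn_dressed_wilson`, via `FlatActionGradient`).  NO supplier letter is proved here;
rung R3, not the Clay problem. [cite: Balaban1985Variational, (46) p.285, (55) p.286, (80)-(89) pp.290-291, Prop. 4 (97)-(98) pp.292-293, (144) p.300, (152) p.301, (157)-(158) p.302] -/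
theorem exists_hWq_dressed_cubeSeq_T3 (F : T3Family) (n K : ℕ) (x₀ : Site (F.P K) 0) (ρ S M : ℕ) (hM : 1 ≤ M) (hS : 2 * F.L ≤ S)
    {w : ℕ → PBond (F.P K) 0 → ℝ} (hw : IsLevWeight F n K (cubeSeqMT3 F n K x₀ ρ S M hM) w) {β' : Type*}
    (H : (β' → Matrix (Fin 2) (Fin 2) ℂ) →ₗ[ℂ] (PBond (F.P K) 0 → Matrix (Fin 2) (Fin 2) ℂ)) (D : (PBond (F.P K) 0 → Matrix (Fin 2) (Fin 2) ℂ) → (β' → Matrix (Fin 2) (Fin 2) ℂ))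
    {B_H C₂ R R₀ a₃ B_Δ B₂ B₃ : ℝ} (hC₂ : 0 ≤ C₂) (hB_H : 0 ≤ B_H) (hB₃ : 0 ≤ B₃) (hR₀0 : 0 ≤ R₀) (hR₀ : R₀ < R) (ha₃ : a₃ ≤ R₀)
    (hθ : (1 + 4 * B_H * C₂ * R₀) * a₃ ≤ 1 / (2 * (F.L : ℝ)))
    (hH : ∀ (X : β' → Matrix (Fin 2) (Fin 2) ℂ) (t : ℝ), (∀ c', ‖X c'‖ ≤ t) →
      (∀ b, w 1 b * ‖H X b‖ ≤ B_H * t) ∧ ∀ (b : PBond (F.P K) 0) (ν : Fin 3), w 2 b * (F.L : ℝ) ^ (K - n) * ‖H X ⟨b.src.shift ν, b.dir⟩ - H X b‖ ≤ B_H * t)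
    (hD : ∀ (Y : PBond (F.P K) 0 → Matrix (Fin 2) (Fin 2) ℂ) (r' : ℝ), r' < R → (∀ b, w 1 b * ‖Y b‖ ≤ r') →
      (∀ (b : PBond (F.P K) 0) (ν : Fin 3), w 2 b * (F.L : ℝ) ^ (K - n) * ‖Y ⟨b.src.shift ν, b.dir⟩ - Y b‖ ≤ r') → ∀ c', ‖D Y c'‖ ≤ 4 * C₂ * r' ^ 2)
    (hX1 : ∀ (X : β' → Matrix (Fin 2) (Fin 2) ℂ) (t : ℝ), 0 ≤ t → (∀ c', ‖X c'‖ ≤ t) → ∀ b : PBond (F.P K) 0,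
      w 3 b * ‖(((((((F.L : ℝ)⁻¹) ^ (K - n)) : ℝ) : ℂ) ^ 2)⁻¹ • ∑ p : Plaq (F.P K) 0, ((Pi.single b (1 : ℂ) : PBond (F.P K) 0 → ℂ) ⟨p.src, p.μ⟩ + (Pi.single b (1 : ℂ) : PBond (F.P K) 0 → ℂ) ⟨p.src.shift p.μ, p.ν⟩ - (Pi.single b (1 : ℂ) : PBond (F.P K) 0 → ℂ) ⟨p.src.shift p.ν, p.μ⟩ - (Pi.single b (1 : ℂ) : PBond (F.P K) 0 → ℂ) ⟨p.src, p.ν⟩) • (H X ⟨p.src, p.μ⟩ + H X ⟨p.src.shift p.μ, p.ν⟩ - H X ⟨p.src.shift p.ν, p.μ⟩ - H X ⟨p.src, p.ν⟩))‖ ≤ B_Δ * t)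
    (hX2a : ∀ (Y : PBond (F.P K) 0 → Matrix (Fin 2) (Fin 2) ℂ) (r : ℝ), r < R → (∀ b, w 1 b * ‖Y b‖ ≤ r) →
      (∀ (b : PBond (F.P K) 0) (ν : Fin 3), w 2 b * (F.L : ℝ) ^ (K - n) * ‖Y ⟨b.src.shift ν, b.dir⟩ - Y b‖ ≤ r) →
      ∀ (Z : PBond (F.P K) 0 → Matrix (Fin 2) (Fin 2) ℂ) (s : ℝ), 0 ≤ s → (∀ b, w 1 b * ‖Z b‖ ≤ s) →
      (∀ (b : PBond (F.P K) 0) (ν : Fin 3), w 2 b * (F.L : ℝ) ^ (K - n) * ‖Z ⟨b.src.shift ν, b.dir⟩ - Z b‖ ≤ s) → ∀ b : PBond (F.P K) 0,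
      w 3 b * ‖(Matrix.of fun i j => ∑ b' : PBond (F.P K) 0, Matrix.trace ((((((((F.L : ℝ)⁻¹) ^ (K - n)) : ℝ) : ℂ) ^ 2)⁻¹ • ∑ p : Plaq (F.P K) 0, ((Pi.single b' (1 : ℂ) : PBond (F.P K) 0 → ℂ) ⟨p.src, p.μ⟩ + (Pi.single b' (1 : ℂ) : PBond (F.P K) 0 → ℂ) ⟨p.src.shift p.μ, p.ν⟩ - (Pi.single b' (1 : ℂ) : PBond (F.P K) 0 → ℂ) ⟨p.src.shift p.ν, p.μ⟩ - (Pi.single b' (1 : ℂ) : PBond (F.P K) 0 → ℂ) ⟨p.src, p.ν⟩) • (Z ⟨p.src, p.μ⟩ + Z ⟨p.src.shift p.μ, p.ν⟩ - Z ⟨p.src.shift p.ν, p.μ⟩ - Z ⟨p.src, p.ν⟩)) * H (fderiv ℂ D Y (Pi.single b (Matrix.single j i (1 : ℂ)))) b'))‖ ≤ B₂ * r * s)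
    (hX2T : ∀ (Y : PBond (F.P K) 0 → Matrix (Fin 2) (Fin 2) ℂ) (r : ℝ), r < R → (∀ b, w 1 b * ‖Y b‖ ≤ r) →
      (∀ (b : PBond (F.P K) 0) (ν : Fin 3), w 2 b * (F.L : ℝ) ^ (K - n) * ‖Y ⟨b.src.shift ν, b.dir⟩ - Y b‖ ≤ r) →
      ∀ (J : PBond (F.P K) 0 → Matrix (Fin 2) (Fin 2) ℂ) (t : ℝ), 0 ≤ t → (∀ b, w 3 b * ‖J b‖ ≤ t) → ∀ b : PBond (F.P K) 0,
      w 3 b * ‖(Matrix.of fun i j => ∑ b' : PBond (F.P K) 0, Matrix.trace (J b' * H (fderiv ℂ D Y (Pi.single b (Matrix.single j i (1 : ℂ)))) b'))‖ ≤ B₃ * r * t) :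
    ∃ W₀ : (PBond (F.P K) 0 → Matrix (Fin 2) (Fin 2) ℂ) → (PBond (F.P K) 0 → Matrix (Fin 2) (Fin 2) ℂ),
      (∀ A δ : PBond (F.P K) 0 → Matrix (Fin 2) (Fin 2) ℂ, fderiv ℂ (fun A : PBond (F.P K) 0 → Matrix (Fin 2) (Fin 2) ℂ => (∑ p : Plaq (F.P K) 0, (1 - (2 : ℂ)⁻¹ * Matrix.trace (exp ((Complex.I * (((((F.L : ℝ)⁻¹) ^ (K - n) : ℝ)) : ℂ)) • A ⟨p.src, p.μ⟩) * exp ((Complex.I * (((((F.L : ℝ)⁻¹) ^ (K - n) : ℝ)) : ℂ)) • A ⟨p.src.shift p.μ, p.ν⟩) * exp (-((Complex.I * (((((F.L : ℝ)⁻¹) ^ (K - n) : ℝ)) : ℂ)) • A ⟨p.src.shift p.ν, p.μ⟩)) * exp (-((Complex.I * (((((F.L : ℝ)⁻¹) ^ (K - n) : ℝ)) : ℂ)) • A ⟨p.src, p.ν⟩))) + (2 : ℂ)⁻¹ * Matrix.trace (((Complex.I * (((((F.L : ℝ)⁻¹) ^ (K - n) : ℝ)) : ℂ)) • A ⟨p.src,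 p.μ⟩) + ((Complex.I * (((((F.L : ℝ)⁻¹) ^ (K - n) : ℝ)) : ℂ)) • A ⟨p.src.shift p.μ, p.ν⟩) + (-((Complex.I * (((((F.L : ℝ)⁻¹) ^ (K - n) : ℝ)) : ℂ)) • A ⟨p.src.shift p.ν, p.μ⟩)) + (-((Complex.I * (((((F.L : ℝ)⁻¹) ^ (K - n) : ℝ)) : ℂ)) • A ⟨p.src, p.ν⟩))) + (4 : ℂ)⁻¹ * Matrix.trace ((((Complex.I * (((((F.L : ℝ)⁻¹) ^ (K - n) : ℝ)) : ℂ)) • A ⟨p.src, p.μ⟩) + ((Complex.I * (((((F.L : ℝ)⁻¹) ^ (K - n) : ℝ)) : ℂ)) • A ⟨p.src.shift p.μ, p.ν⟩) + (-((Complex.I * (((((F.L : ℝ)⁻¹) ^ (K - n) : ℝ)) : ℂ)) • A ⟨p.src.shift p.ν, p.μ⟩)) + (-((Complex.I * (((((F.L : ℝ)⁻¹) ^ (K - n) : ℝ)) : ℂ)) • A ⟨p.src, p.ν⟩))) ^ 2)))) A δ =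
        ((((F.L : ℝ)⁻¹) ^ (K - n) : ℝ) : ℂ) ^ 4 * ∑ b : PBond (F.P K) 0, Matrix.trace (W₀ A b * δ b)) ∧
      Differentiable ℂ W₀ ∧
      ∀ E : (PBond (F.P K) 0 → Matrix (Fin 2) (Fin 2) ℂ) → (PBond (F.P K) 0 → Matrix (Fin 2) (Fin 2) ℂ),
        (∀ (Y : PBond (F.P K) 0 → Matrix (Fin 2) (Fin 2) ℂ) (b : PBond (F.P K) 0) (i j : Fin 2), E Y b i j = ((((((F.L : ℝ)⁻¹) ^ (K - n)) : ℝ) : ℂ) ^ 4)⁻¹ *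
          (-(((((((F.L : ℝ)⁻¹) ^ (K - n)) : ℝ) : ℂ) ^ 2 / 2) * ∑ p : Plaq (F.P K) 0, Matrix.trace ((H (D Y) ⟨p.src, p.μ⟩ + H (D Y) ⟨p.src.shift p.μ, p.ν⟩ - H (D Y) ⟨p.src.shift p.ν, p.μ⟩ - H (D Y) ⟨p.src, p.ν⟩) *
              (((Pi.single b (Matrix.single j i (1 : ℂ)) : PBond (F.P K) 0 → Matrix (Fin 2) (Fin 2) ℂ)) ⟨p.src, p.μ⟩ + ((Pi.single b (Matrix.single j i (1 : ℂ)) : PBond (F.P K) 0 → Matrix (Fin 2) (Fin 2) ℂ)) ⟨p.src.shift p.μ, p.ν⟩ -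
                ((Pi.single b (Matrix.single j i (1 : ℂ)) : PBond (F.P K) 0 → Matrix (Fin 2) (Fin 2) ℂ)) ⟨p.src.shift p.ν, p.μ⟩ - ((Pi.single b (Matrix.single j i (1 : ℂ)) : PBond (F.P K) 0 → Matrix (Fin 2) (Fin 2) ℂ)) ⟨p.src, p.ν⟩)))
            - ((((((F.L : ℝ)⁻¹) ^ (K - n)) : ℝ) : ℂ) ^ 2 / 2) * ∑ p : Plaq (F.P K) 0, Matrix.trace (((Y - H (D Y)) ⟨p.src, p.μ⟩ + (Y - H (D Y)) ⟨p.src.shift p.μ, p.ν⟩ - (Y - H (D Y)) ⟨p.src.shift p.ν, p.μ⟩ - (Y - H (D Y)) ⟨p.src, p.ν⟩) *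
              (H (fderiv ℂ D Y (Pi.single b (Matrix.single j i (1 : ℂ)))) ⟨p.src, p.μ⟩ + H (fderiv ℂ D Y (Pi.single b (Matrix.single j i (1 : ℂ)))) ⟨p.src.shift p.μ, p.ν⟩ -
                H (fderiv ℂ D Y (Pi.single b (Matrix.single j i (1 : ℂ)))) ⟨p.src.shift p.ν, p.μ⟩ - H (fderiv ℂ D Y (Pi.single b (Matrix.single j i (1 : ℂ)))) ⟨p.src, p.ν⟩))
            - (((((F.L : ℝ)⁻¹) ^ (K - n)) : ℝ) : ℂ) ^ 4 * ∑ b' : PBond (F.P K) 0, Matrix.trace (W₀ (Y - H (D Y)) b' * H (fderiv ℂ D Y (Pi.single b (Matrix.single j i (1 : ℂ)))) b'))) →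
        ∀ (Y : PBond (F.P K) 0 → Matrix (Fin 2) (Fin 2) ℂ) (r : ℝ), r < a₃ → (∀ b, w 1 b * ‖Y b‖ ≤ r) →
          (∀ (b : PBond (F.P K) 0) (ν : Fin 3), w 2 b * (F.L : ℝ) ^ (K - n) * ‖Y ⟨b.src.shift ν, b.dir⟩ - Y b‖ ≤ r) →
          ∀ b, w 3 b * ‖(W₀ (Y - H (D Y)) + E Y) b‖ ≤
            (12 * ((F.L : ℝ) ^ 3 * (1428 + (F.L : ℝ))) * (1 + 4 * B_H * C₂ * R₀) ^ 2 +
              (2 * B_Δ * C₂ + 2⁻¹ * B₂ * (1 + 4 * B_H * C₂ * R₀) +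
                B₃ * R₀ * (12 * ((F.L : ℝ) ^ 3 * (1428 + (F.L : ℝ)))) * (1 + 4 * B_H * C₂ * R₀) ^ 2)) * r ^ 2 := by
  obtain ⟨W₀, hgrad, hW₀d, -, hW₀q⟩ := exists_gradient_weighted98_cubeSeq_T3 F n K x₀ ρ S M hM hS hw
  refine ⟨W₀, hgrad, hW₀d, fun E hE => ?_⟩
  have hL0 : (0 : ℝ) < F.L := by exact_mod_cast F.hL.2.le.trans_lt' zero_lt_one
  have hη : (((F.L : ℝ)⁻¹) ^ (K - n)) ≠ 0 := pow_ne_zero _ (inv_ne_zero hL0.ne')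
  have hwnn : ∀ m b, 0 ≤ w m b := fun m b => by rw [hw m b]; positivity
  have hc : (0 : ℝ) ≤ (F.L : ℝ) ^ (K - n) := by positivity
  exact hWq_dressed_of_letters (((F.L : ℝ)⁻¹) ^ (K - n)) hη w hwnn ((F.L : ℝ) ^ (K - n)) hc (fun Y => W₀ (Y - H (D Y)) + E Y) W₀ E H D (fun Y => rfl) hE
    hW₀q hH hD hX1 hX2a hX2T hC₂ hB_H hB₃ hR₀0 hR₀ ha₃ hθ

/-- **THE ONE-LEVEL READING — LITERALLY THE `hE` BINDER OF ✓ `FlatProp4Dressing.exists_dressed_gradient_T3`** (fine torus `PBond (F.P K) 0`, `w₀ = w₃ = 1`,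
`w₁ = L^{K−n}`, gradient letter in the `∀ s μ ν` form): for the EXPLICIT `E` of `fderiv_dressed_eq_pairing` (any `W₀` with a one-level (98) letter `C₀` below
`a₀`, e.g. P3b's `18000` below `½`), the one-level letters (46), (55), (X1), (X2a), (X2-T) give `‖E Y b‖ ≤ C_E·r²` for every `Y` of one-level size `≤ r < a₃`
(`a₃ ≤ R₀ < R`, `θa₃ ≤ a₀`), `C_E = 2B_ΔC₂ + ½B₂θ + B₃R₀C₀θ²` — so `exists_dressed_gradient_T3` applies with its `R := a₃`.
[cite: Balaban1985Variational, (80)-(89) pp.290-291, Prop. 4 (97)-(98) pp.292-293, (157) p.302] -/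
theorem hE_T3_of_letters (F : T3Family) (n K : ℕ) {β' : Type*}
    (W₀ E : (PBond (F.P K) 0 → Matrix (Fin 2) (Fin 2) ℂ) → (PBond (F.P K) 0 → Matrix (Fin 2) (Fin 2) ℂ))
    (H : (β' → Matrix (Fin 2) (Fin 2) ℂ) →ₗ[ℂ] (PBond (F.P K) 0 → Matrix (Fin 2) (Fin 2) ℂ)) (D : (PBond (F.P K) 0 → Matrix (Fin 2) (Fin 2) ℂ) → (β' → Matrix (Fin 2) (Fin 2) ℂ))
    {C₀ a₀ B_H C₂ R R₀ a₃ B_Δ B₂ B₃ : ℝ}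
    (hE : ∀ (Y : PBond (F.P K) 0 → Matrix (Fin 2) (Fin 2) ℂ) (b : PBond (F.P K) 0) (i j : Fin 2), E Y b i j = ((((((F.L : ℝ)⁻¹) ^ (K - n)) : ℝ) : ℂ) ^ 4)⁻¹ *
      (-(((((((F.L : ℝ)⁻¹) ^ (K - n)) : ℝ) : ℂ) ^ 2 / 2) * ∑ p : Plaq (F.P K) 0, Matrix.trace ((H (D Y) ⟨p.src, p.μ⟩ + H (D Y) ⟨p.src.shift p.μ, p.ν⟩ - H (D Y) ⟨p.src.shift p.ν, p.μ⟩ - H (D Y) ⟨p.src, p.ν⟩) *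
          (((Pi.single b (Matrix.single j i (1 : ℂ)) : PBond (F.P K) 0 → Matrix (Fin 2) (Fin 2) ℂ)) ⟨p.src, p.μ⟩ + ((Pi.single b (Matrix.single j i (1 : ℂ)) : PBond (F.P K) 0 → Matrix (Fin 2) (Fin 2) ℂ)) ⟨p.src.shift p.μ, p.ν⟩ -
            ((Pi.single b (Matrix.single j i (1 : ℂ)) : PBond (F.P K) 0 → Matrix (Fin 2) (Fin 2) ℂ)) ⟨p.src.shift p.ν, p.μ⟩ - ((Pi.single b (Matrix.single j i (1 : ℂ)) : PBond (F.P K) 0 → Matrix (Fin 2) (Fin 2) ℂ)) ⟨p.src, p.ν⟩)))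
        - ((((((F.L : ℝ)⁻¹) ^ (K - n)) : ℝ) : ℂ) ^ 2 / 2) * ∑ p : Plaq (F.P K) 0, Matrix.trace (((Y - H (D Y)) ⟨p.src, p.μ⟩ + (Y - H (D Y)) ⟨p.src.shift p.μ, p.ν⟩ - (Y - H (D Y)) ⟨p.src.shift p.ν, p.μ⟩ - (Y - H (D Y)) ⟨p.src, p.ν⟩) *
          (H (fderiv ℂ D Y (Pi.single b (Matrix.single j i (1 : ℂ)))) ⟨p.src, p.μ⟩ + H (fderiv ℂ D Y (Pi.single b (Matrix.single j i (1 : ℂ)))) ⟨p.src.shift p.μ, p.ν⟩ -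
            H (fderiv ℂ D Y (Pi.single b (Matrix.single j i (1 : ℂ)))) ⟨p.src.shift p.ν, p.μ⟩ - H (fderiv ℂ D Y (Pi.single b (Matrix.single j i (1 : ℂ)))) ⟨p.src, p.ν⟩))
        - (((((F.L : ℝ)⁻¹) ^ (K - n)) : ℝ) : ℂ) ^ 4 * ∑ b' : PBond (F.P K) 0, Matrix.trace (W₀ (Y - H (D Y)) b' * H (fderiv ℂ D Y (Pi.single b (Matrix.single j i (1 : ℂ)))) b')))
    (hW₀ : ∀ (Z : PBond (F.P K) 0 → Matrix (Fin 2) (Fin 2) ℂ) (s : ℝ), s < a₀ → (∀ b, ‖Z b‖ ≤ s) → (∀ (x : Site (F.P K) 0) (μ ν : Fin 3), (F.L : ℝ) ^ (K - n) * ‖Z ⟨x.shift ν, μ⟩ - Z ⟨x, μ⟩‖ ≤ s) → ∀ b, ‖W₀ Z b‖ ≤ C₀ * s ^ 2)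
    (hH : ∀ (X : β' → Matrix (Fin 2) (Fin 2) ℂ) (t : ℝ), (∀ c', ‖X c'‖ ≤ t) →
      (∀ b, ‖H X b‖ ≤ B_H * t) ∧ ∀ (x : Site (F.P K) 0) (μ ν : Fin 3), (F.L : ℝ) ^ (K - n) * ‖H X ⟨x.shift ν, μ⟩ - H X ⟨x, μ⟩‖ ≤ B_H * t)
    (hD : ∀ (Y : PBond (F.P K) 0 → Matrix (Fin 2) (Fin 2) ℂ) (r' : ℝ), r' < R → (∀ b, ‖Y b‖ ≤ r') → (∀ (x : Site (F.P K) 0) (μ ν : Fin 3), (F.L : ℝ) ^ (K - n) * ‖Y ⟨x.shift ν, μ⟩ - Y ⟨x, μ⟩‖ ≤ r') → ∀ c', ‖D Y c'‖ ≤ 4 * C₂ * r' ^ 2)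
    (hX1 : ∀ (X : β' → Matrix (Fin 2) (Fin 2) ℂ) (t : ℝ), 0 ≤ t → (∀ c', ‖X c'‖ ≤ t) → ∀ b : PBond (F.P K) 0, ‖(((((((F.L : ℝ)⁻¹) ^ (K - n)) : ℝ) : ℂ) ^ 2)⁻¹ • ∑ p : Plaq (F.P K) 0, ((Pi.single b (1 : ℂ) : PBond (F.P K) 0 → ℂ) ⟨p.src, p.μ⟩ + (Pi.single b (1 : ℂ) : PBond (F.P K) 0 → ℂ) ⟨p.src.shift p.μ, p.ν⟩ - (Pi.single b (1 : ℂ) : PBond (F.P K) 0 → ℂ) ⟨p.src.shift p.ν, p.μ⟩ - (Pi.single b (1 : ℂ) : PBond (F.P K) 0 → ℂ) ⟨p.src, p.ν⟩) • (H X ⟨p.src, p.μ⟩ + H X ⟨p.src.shift p.μ, p.ν⟩ - H X ⟨p.src.shift p.ν, p.μ⟩ - H X ⟨p.src, p.ν⟩))‖ ≤ B_Δ * t)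
    (hX2a : ∀ (Y : PBond (F.P K) 0 → Matrix (Fin 2) (Fin 2) ℂ) (r : ℝ), r < R → (∀ b, ‖Y b‖ ≤ r) → (∀ (x : Site (F.P K) 0) (μ ν : Fin 3), (F.L : ℝ) ^ (K - n) * ‖Y ⟨x.shift ν, μ⟩ - Y ⟨x, μ⟩‖ ≤ r) →
      ∀ (Z : PBond (F.P K) 0 → Matrix (Fin 2) (Fin 2) ℂ) (s : ℝ), 0 ≤ s → (∀ b, ‖Z b‖ ≤ s) → (∀ (x : Site (F.P K) 0) (μ ν : Fin 3), (F.L : ℝ) ^ (K - n) * ‖Z ⟨x.shift ν, μ⟩ - Z ⟨x, μ⟩‖ ≤ s) → ∀ b : PBond (F.P K) 0,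
      ‖(Matrix.of fun i j => ∑ b' : PBond (F.P K) 0, Matrix.trace ((((((((F.L : ℝ)⁻¹) ^ (K - n)) : ℝ) : ℂ) ^ 2)⁻¹ • ∑ p : Plaq (F.P K) 0, ((Pi.single b' (1 : ℂ) : PBond (F.P K) 0 → ℂ) ⟨p.src, p.μ⟩ + (Pi.single b' (1 : ℂ) : PBond (F.P K) 0 → ℂ) ⟨p.src.shift p.μ, p.ν⟩ - (Pi.single b' (1 : ℂ) : PBond (F.P K) 0 → ℂ) ⟨p.src.shift p.ν, p.μ⟩ - (Pi.single b' (1 : ℂ) : PBond (F.P K) 0 → ℂ) ⟨p.src, p.ν⟩) • (Z ⟨p.src, p.μ⟩ + Z ⟨p.src.shift p.μ, p.ν⟩ - Z ⟨p.src.shift p.ν, p.μ⟩ - Z ⟨p.src, p.ν⟩)) * H (fderiv ℂ D Y (Pi.single b (Matrix.single j i (1 : ℂ)))) b'))‖ ≤ B₂ * r * s)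
    (hX2T : ∀ (Y : PBond (F.P K) 0 → Matrix (Fin 2) (Fin 2) ℂ) (r : ℝ), r < R → (∀ b, ‖Y b‖ ≤ r) → (∀ (x : Site (F.P K) 0) (μ ν : Fin 3), (F.L : ℝ) ^ (K - n) * ‖Y ⟨x.shift ν, μ⟩ - Y ⟨x, μ⟩‖ ≤ r) →
      ∀ (J : PBond (F.P K) 0 → Matrix (Fin 2) (Fin 2) ℂ) (t : ℝ), 0 ≤ t → (∀ b, ‖J b‖ ≤ t) → ∀ b : PBond (F.P K) 0, ‖(Matrix.of fun i j => ∑ b' : PBond (F.P K) 0, Matrix.trace (J b' * H (fderiv ℂ D Y (Pi.single b (Matrix.single j i (1 : ℂ)))) b'))‖ ≤ B₃ * r * t)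
    (hC₂ : 0 ≤ C₂) (hB_H : 0 ≤ B_H) (hB₃ : 0 ≤ B₃) (hR₀0 : 0 ≤ R₀) (hR₀ : R₀ < R) (ha₃ : a₃ ≤ R₀) (hθ : (1 + 4 * B_H * C₂ * R₀) * a₃ ≤ a₀) :
    ∀ (Y : PBond (F.P K) 0 → Matrix (Fin 2) (Fin 2) ℂ) (r : ℝ), r < a₃ → (∀ b, ‖Y b‖ ≤ r) → (∀ (x : Site (F.P K) 0) (μ ν : Fin 3), (F.L : ℝ) ^ (K - n) * ‖Y ⟨x.shift ν, μ⟩ - Y ⟨x, μ⟩‖ ≤ r) →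
      ∀ b, ‖E Y b‖ ≤ (2 * B_Δ * C₂ + 2⁻¹ * B₂ * (1 + 4 * B_H * C₂ * R₀) + B₃ * R₀ * C₀ * (1 + 4 * B_H * C₂ * R₀) ^ 2) * r ^ 2 := by
  have hL0 : (0 : ℝ) < F.L := by exact_mod_cast F.hL.2.le.trans_lt' zero_lt_one
  have hη : (((F.L : ℝ)⁻¹) ^ (K - n)) ≠ 0 := pow_ne_zero _ (inv_ne_zero hL0.ne')
  have hLk : (0 : ℝ) ≤ (F.L : ℝ) ^ (K - n) := by positivity
  -- generic currency: `ι = PBond`, `κ = Site × Fin 3 × Fin 3`, `src (s,μ,ν) = ⟨s, μ⟩`, `tgt (s,μ,ν) = ⟨s + e_ν, μ⟩`, `w₀ = w₃ = 1`, `w₁ = L^{K−n}`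
  let src : Site (F.P K) 0 × Fin 3 × Fin 3 → PBond (F.P K) 0 := fun q => ⟨q.1, q.2.1⟩
  let tgt : Site (F.P K) 0 × Fin 3 × Fin 3 → PBond (F.P K) 0 := fun q => ⟨q.1.shift q.2.2, q.2.1⟩
  have toP : ∀ (Y : PBond (F.P K) 0 → Matrix (Fin 2) (Fin 2) ℂ) (r : ℝ), (∀ (x : Site (F.P K) 0) (μ ν : Fin 3), (F.L : ℝ) ^ (K - n) * ‖Y ⟨x.shift ν, μ⟩ - Y ⟨x, μ⟩‖ ≤ r) →
      ∀ q : Site (F.P K) 0 × Fin 3 × Fin 3, (F.L : ℝ) ^ (K - n) * ‖Y (tgt q) - Y (src q)‖ ≤ r := fun Y r h q => h q.1 q.2.1 q.2.2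
  have ofP : ∀ (Y : PBond (F.P K) 0 → Matrix (Fin 2) (Fin 2) ℂ) (r : ℝ), (∀ q : Site (F.P K) 0 × Fin 3 × Fin 3, (F.L : ℝ) ^ (K - n) * ‖Y (tgt q) - Y (src q)‖ ≤ r) →
      (∀ (x : Site (F.P K) 0) (μ ν : Fin 3), (F.L : ℝ) ^ (K - n) * ‖Y ⟨x.shift ν, μ⟩ - Y ⟨x, μ⟩‖ ≤ r) := fun Y r h x μ ν => h (x, μ, ν)
  have to1 : ∀ (Y : PBond (F.P K) 0 → Matrix (Fin 2) (Fin 2) ℂ) (r : ℝ), (∀ b, ‖Y b‖ ≤ r) → ∀ b, (1 : ℝ) * ‖Y b‖ ≤ r := fun Y r h b => by rw [one_mul]; exact h b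
  have of1 : ∀ (Y : PBond (F.P K) 0 → Matrix (Fin 2) (Fin 2) ℂ) (r : ℝ), (∀ b, (1 : ℝ) * ‖Y b‖ ≤ r) → ∀ b, ‖Y b‖ ≤ r := fun Y r h b => by rw [← one_mul ‖Y b‖]; exact h b
  intro Y r hr h1 h2 b
  have h := hE_of_letters src tgt (fun _ => (1 : ℝ)) (fun _ => (1 : ℝ)) (fun _ => (F.L : ℝ) ^ (K - n)) E W₀
    (fun (Z : PBond (F.P K) 0 → Matrix (Fin 2) (Fin 2) ℂ) (b₀ : PBond (F.P K) 0) => (((((((F.L : ℝ)⁻¹) ^ (K - n)) : ℝ) : ℂ) ^ 2)⁻¹ • ∑ p : Plaq (F.P K) 0, ((Pi.single b₀ (1 : ℂ) : PBond (F.P K) 0 → ℂ) ⟨p.src, p.μ⟩ + (Pi.single b₀ (1 : ℂ) : PBond (F.P K) 0 → ℂ) ⟨p.src.shift p.μ, p.ν⟩ - (Pi.single b₀ (1 : ℂ) : PBond (F.P K) 0 → ℂ) ⟨p.src.shift p.ν, p.μ⟩ - (Pi.single b₀ (1 : ℂ) : PBond (F.P K) 0 → ℂ) ⟨p.src, p.ν⟩)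 • (Z ⟨p.src, p.μ⟩ + Z ⟨p.src.shift p.μ, p.ν⟩ - Z ⟨p.src.shift p.ν, p.μ⟩ - Z ⟨p.src, p.ν⟩)))
    (fun (Y₀ J : PBond (F.P K) 0 → Matrix (Fin 2) (Fin 2) ℂ) (b₀ : PBond (F.P K) 0) => (Matrix.of fun i j => ∑ b' : PBond (F.P K) 0, Matrix.trace (J b' * H (fderiv ℂ D Y₀ (Pi.single b₀ (Matrix.single j i (1 : ℂ)))) b')))
    H D (dressing_eq_three_terms (((F.L : ℝ)⁻¹) ^ (K - n)) hη W₀ H D E hE)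
    (fun Z s hs hZ1 hZ2 => to1 _ _ (hW₀ Z s hs (of1 Z s hZ1) (ofP Z s hZ2)))
    (fun X t hX => ⟨to1 _ _ (hH X t hX).1, toP _ _ (hH X t hX).2⟩)
    (fun Y r' hr' hY1 hY2 => hD Y r' hr' (of1 Y r' hY1) (ofP Y r' hY2))
    (fun X t ht hX b => by rw [one_mul]; exact hX1 X t ht hX b)
    (fun Y r hr hY1 hY2 Z s hs hZ1 hZ2 b => by
      rw [one_mul]; exact hX2a Y r hr (of1 Y r hY1) (ofP Y r hY2) Z s hs (of1 Z s hZ1) (ofP Z s hZ2) b)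
    (fun Y r hr hY1 hY2 J t ht hJ b => by rw [one_mul]; exact hX2T Y r hr (of1 Y r hY1) (ofP Y r hY2) J t ht (of1 _ _ hJ) b)
    hC₂ hB_H hB₃ hR₀0 hR₀ ha₃ hθ (fun _ => zero_le_one) (fun _ => hLk) (fun _ => zero_le_one)
    Y r hr (to1 Y r h1) (toP Y r h2) b
  rwa [one_mul] at h

end T3

end Summit.QuantumFields.YangMills.Theorems.HalvingDressingLetter

end
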